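import Mathlib
import HarnessLib
import Literature.Probability.LatticeModels.RandomClusterShiftedBoxes
import Literature.Probability.LatticeModels.IsingPlusEdwardsSokal
import Literature.Probability.LatticeModels.PlusMinusStateGibbs
import Literature.Probability.LatticeModels.CriticalTwoPointBounds
import Literature.Barriers.CriticalPhenomena.RandomClusterFirstOrder

/-!
# The arm to the boundary of a large box vanishes for the critical FK-Ising model on `ℤ^d`, `d ≥ 3`

Topic `Literature/Probability/LatticeModels`. For the wired FK-Ising random-cluster measure of boxes of
`ℤ^d` at `p = 1 - e^{-2β_c(d)}`, `q = 2`: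

* `tendsto_thetaWiredBox_criticalBeta_zero` — `φ¹_{Λ_L}(0 ↔ ∂Λ_L) → 0` as `L → ∞` for `d ≥ 3`: the
  wired one-arm probability of `Λ_{n+1}` is the plus magnetisation `⟨σ_0⟩⁺_{Λ_n;β_c}` (Edwards–Sokal with
  wired/plus boundary, `thetaWiredBox_succ_eq_isingCorr_plus`), which converges
  (`tendsto_isingCorr_plus_box`) to `m*(β_c) = 0` (Aizenman–Duminil-Copin–Sidoravicius 2015;
  `spontaneousMagnetization_criticalBeta_eq_zero_holds`);
* `rcMeasure_real_siteArm_icc_le_thetaWiredBox` — for every coordinate box `Δ ⊇ x + Λ_r`, the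
  `φ¹_Δ`-probability that `x` is joined to `∂Δ` by an open path is at most `φ¹_{Λ_r}(0 ↔ ∂Λ_r)` (the
  path passes `∂(x + Λ_r)`, Grimmett 2006, proof of Prop. (5.11); monotonicity in the domain, (4.24);
  invariance under the translation `τ_x`, §4.3) — any `0 ≤ p ≤ 1`, `q ≥ 1`, `d ≥ 1`;
* `tendsto_rcMeasure_real_siteArm_criticalBeta` — hence along the translated boxes `Λ_L + v` the
  critical arm probability of every fixed lattice point tends to `0` (`d ≥ 3`).

Used by the route `CriticalPhenomena/Ising3DConformalLimit/ArmDressing` (crux `BallConnectivityMoebius`).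

## References

* G. Grimmett, *The Random-Cluster Model* (2006), §4.3, Thm. (4.19)(a) proof eq. (4.24),
  Prop. (5.11). [Grimmett2006]
* M. Aizenman, H. Duminil-Copin, V. Sidoravicius, Comm. Math. Phys. 334 (2015), Thm. 1.2 with
  Cor. 1.5 (1). [AizenmanDuminilCopinSidoraviciusCMP2015]
-/

noncomputable section

namespace Literature.Probability.LatticeModels

open _root_.MeasureTheory Finset SimpleGraph Filter _root_.Topology
open Literature.Probability.Percolation Literature.Barriers.CriticalPhenomena

section Arm

variable {d : ℕ}

/-- The wired random-cluster measure `φ¹_{S,p,q}` of the finite piece `S` of `ℤ^d`. -/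
local notation "μ[" p ", " q "](" S ")" =>
  rcMeasure (finsetGraph (zdGraph _) S) p q (wiredBoundary (zdGraph _) S)

/-- The translated box `Λ_L + v = ∏ᵢ [-L + vᵢ, L + vᵢ]`. -/
local notation "Λ⟦" v ", " L "⟧" =>
  Finset.Icc (fun i => -((L : ℕ) : ℤ) + (v : Site _) i) (fun i => ((L : ℕ) : ℤ) + (v : Site _) i)

/-! ### The wired one-arm probability of the centred box vanishes at `β_c(d)`, `d ≥ 3` -/

/-- **`φ¹_{Λ_L, p_c, 2}(0 ↔ ∂Λ_L) → 0` on `ℤ^d`, `d ≥ 3`**: by the Edwards–Sokal coupling with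
wired/plus boundary the one-arm probability of `Λ_{n+1}` is `⟨σ_0⟩⁺_{Λ_n;β_c,0}`, which tends to the
spontaneous magnetisation `m*(β_c(d)) = 0` (continuity of the magnetisation at `β_c` for `d ≥ 3`).
[cite: AizenmanDuminilCopinSidoraviciusCMP2015, Thm. 1.2 with Cor. 1.5 (1)] -/
theorem tendsto_thetaWiredBox_criticalBeta_zero (hd : 3 ≤ d) :
    Tendsto (fun L : ℕ => thetaWiredBox d (fkIsingParam (criticalBeta d)) 2 L) atTop (𝓝 0) := by
  have hd0 : 0 < d := by omega
  have hβ : 0 ≤ criticalBeta d := criticalBeta_nonneg d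
  have h1 : Tendsto (fun n : ℕ => thetaWiredBox d (fkIsingParam (criticalBeta d)) 2 (n + 1))
      atTop (𝓝 0) := by
    have h2 := tendsto_isingCorr_plus_box (d := d) hβ 0 ({0} : Finset (Site d))
    rw [← spontaneousMagnetization_eq_plusCorr,
      spontaneousMagnetization_criticalBeta_eq_zero_holds hd] at h2
    refine h2.congr fun n => ?_
    exact (thetaWiredBox_succ_eq_isingCorr_plus hd0 hβ n).symm
  exact (tendsto_add_atTop_iff_nat 1).1 h1

/-! ### Transport of open paths under relabelling; the arm event in a translated box -/

/-- Open paths are transported by the relabelling of configurations along a graph isomorphism: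
`φ x ↔ φ y` in `φ ω` iff `x ↔ y` in `ω`. [folklore] -/
theorem reachable_relabel_graphIso_iff {V W : Type*} {G : SimpleGraph V} {G' : SimpleGraph W}
    (φ : G ≃g G') (ω : BondConfig V) (x y : V) :
    (openGraph (BondConfig.relabel (sym2Equiv φ.toEquiv) ω)).Reachable (φ x) (φ y) ↔
      (openGraph ω).Reachable x y :=
  SimpleGraph.Iso.reachable_iff
    (φ := (⟨φ.toEquiv, fun {a b} => openGraph_relabel_adj_iff φ.toEquiv ω a b⟩ :
      openGraph ω ≃g openGraph (BondConfig.relabel (sym2Equiv φ.toEquiv) ω)))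

/-- Arm events `{x ↔ ∂S}` are increasing. [folklore] -/
theorem isUpperSet_siteArmEvent (S : Finset (Site d)) (x : Site d) :
    IsUpperSet {ω : BondConfig ↥S | ∃ a y : ↥S, a.1 = x ∧ y ∈ wiredBoundary (zdGraph d) S ∧
      (openGraph ω).Reachable a y} := by
  rintro ω ω' hle ⟨a, y, ha, hy, hreach⟩
  exact ⟨a, y, ha, hy, hreach.mono (fromEdgeSet_mono hle)⟩

/-- **The arm probability of the centre of a translated box is the wired one-arm probability**
(invariance of `rcMeasure` under the translation `τ_x`, Grimmett 2006, §4.3; only `≤` is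
recorded): `φ¹_{x + Λ_r}(x ↔ ∂(x + Λ_r)) ≤ φ¹_{Λ_r}(0 ↔ ∂Λ_r)`. [cite: Grimmett2006, §4.3] -/
theorem rcMeasure_real_siteArm_icc_shift_le_thetaWiredBox {p q : ℝ} (hp : p ∈ Set.Icc (0 : ℝ) 1)
    (hq : 0 < q) (x : Site d) (r : ℕ) :
    (μ[p, q](Λ⟦x, r⟧)).real {ω | ∃ a y : ↥Λ⟦x, r⟧, a.1 = x ∧
        y ∈ wiredBoundary (zdGraph d) Λ⟦x, r⟧ ∧ (openGraph ω).Reachable a y} ≤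
      thetaWiredBox d p q r := by
  have key := rcMeasure_real_preimage_relabel (finsetGraphIso (zdShiftIso x) (mem_icc_shift_iff r x))
    hp hq (wiredBoundary (zdGraph d) (box d r))
    {ω | ∃ a y : ↥Λ⟦x, r⟧, a.1 = x ∧
        y ∈ wiredBoundary (zdGraph d) Λ⟦x, r⟧ ∧ (openGraph ω).Reachable a y}
  rw [image_finsetGraphIso_wiredBoundary] at key
  rw [← key]
  show _ ≤ (rcMeasure (finsetGraph (zdGraph d) (box d r)) p q (wiredBoundary (zdGraph d) (box d r))).real
    {ω | ∃ y : BoxV d r, y ∈ boxBoundary d r ∧ (openGraph ω).Reachable (boxOrigin d r) y}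
  refine rcMeasure_real_mono_on_edgeSets _ hp hq _ (fun ω _ hω => ?_)
  obtain ⟨a, y, ha, hy, hreach⟩ := hω
  rw [← image_finsetGraphIso_wiredBoundary (zdShiftIso x) (mem_icc_shift_iff r x)] at hy
  obtain ⟨y₀, hy₀, rfl⟩ := hy
  have ha₀ : finsetGraphIso (zdShiftIso x) (mem_icc_shift_iff r x) (boxOrigin d r) = a := by
    apply Subtype.ext
    rw [finsetGraphIso_apply_coe, zdShiftIso_apply, ha]
    exact zero_add x
  rw [← ha₀, reachable_relabel_graphIso_iff] at hreach
  exact ⟨y₀, hy₀, hreach⟩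

/-- The centre belongs to the translated box. [folklore] -/
theorem centre_mem_icc_shift (x : Site d) (r : ℕ) : x ∈ Λ⟦x, r⟧ := by
  rw [mem_siteIcc_iff]
  intro i
  constructor <;> omega

/-- **The arm to the boundary of a box containing `x + Λ_r` is at most the one-arm probability of
`Λ_r`** (Grimmett 2006, proof of Prop. (5.11): an open path from `x` to `∂Δ` passes `∂(x + Λ_r)`,
an increasing event of the sub-box; then monotonicity in the domain, eq. (4.24), and translation
invariance): `φ¹_Δ(x ↔ ∂Δ) ≤ φ¹_{Λ_r}(0 ↔ ∂Λ_r)` for `x + Λ_r ⊆ Δ`, `0 ≤ p ≤ 1`, `q ≥ 1`, `d ≥ 1`.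
[cite: Grimmett2006, Prop. (5.11) (proof) and Thm. (4.19)(a), proof, eq. (4.24)] -/
theorem rcMeasure_real_siteArm_icc_le_thetaWiredBox (hd : 0 < d) {p q : ℝ} (hp : p ∈ Set.Icc (0 : ℝ) 1)
    (hq : 1 ≤ q) (x : Site d) (r : ℕ) {a' b' : Site d} (h : Λ⟦x, r⟧ ⊆ Finset.Icc a' b') :
    (μ[p, q](Finset.Icc a' b')).real {ω | ∃ a y : ↥(Finset.Icc a' b'), a.1 = x ∧
        y ∈ wiredBoundary (zdGraph d) (Finset.Icc a' b') ∧ (openGraph ω).Reachable a y} ≤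
      thetaWiredBox d p q r := by
  have hq0 : 0 < q := one_pos.trans_le hq
  have hxS : x ∈ Λ⟦x, r⟧ := centre_mem_icc_shift x r
  refine le_trans ?_ (rcMeasure_real_siteArm_icc_shift_le_thetaWiredBox hp hq0 x r)
  calc _ ≤ (μ[p, q](Finset.Icc a' b')).real (finsetRestrict h ⁻¹' {ξ | ∃ a y : ↥Λ⟦x, r⟧, a.1 = x ∧
          y ∈ wiredBoundary (zdGraph d) Λ⟦x, r⟧ ∧ (openGraph ξ).Reachable a y}) := by
        refine rcMeasure_real_mono_on_edgeSets _ hp hq0 _ (fun ω hω hmem => ?_)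
        obtain ⟨a, y, ha, hy, hreach⟩ := hmem
        have hax : a = finsetIncl h ⟨x, hxS⟩ := Subtype.ext ha
        rw [hax] at hreach
        obtain ⟨z, hz, hxz⟩ := exists_reachable_wiredBoundary_restrict h hω hy hreach
        exact ⟨⟨x, hxS⟩, z, rfl, hz, hxz⟩
    _ ≤ _ := rcMeasure_real_icc_restrict_le h hd
          (fun i => show -((r : ℕ) : ℤ) + x i ≤ ((r : ℕ) : ℤ) + x i by omega) hp hq
          (isUpperSet_siteArmEvent _ x)

/-- The box `x + Λ_{L - ‖x - v‖}` centred at `x` lies in `Λ_L + v` (`‖x - v‖ ≤ L`). [folklore] -/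
theorem icc_shift_centre_subset (x v : Site d) {L : ℕ} (hL : siteRad (x - v) ≤ L) :
    Λ⟦x, L - siteRad (x - v)⟧ ⊆ Λ⟦v, L⟧ := by
  intro y hy
  rw [mem_siteIcc_iff] at hy ⊢
  intro i
  have h1 := hy i
  have h2 : ((x - v) i).natAbs ≤ siteRad (x - v) :=
    Finset.le_sup (f := fun i => ((x - v) i).natAbs) (Finset.mem_univ i)
  rw [Pi.sub_apply] at h2
  have h3 : (((L - siteRad (x - v) : ℕ) : ℤ)) = (L : ℤ) - (siteRad (x - v) : ℕ) := by
    push_cast [Nat.cast_sub hL]; ring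
  rw [h3] at h1
  omega

/-- **The arm to the boundary vanishes along translated boxes** at `p = 1 - e^{-2β_c(d)}`, `q = 2`,
`d ≥ 3`: for all `v, x ∈ ℤ^d`, `φ¹_{Λ_L + v}(x ↔ ∂(Λ_L + v)) → 0` as `L → ∞` (it is at most
`φ¹_{Λ_{L - ‖x-v‖}}(0 ↔ ∂) → m*(β_c) = 0`). [cite: AizenmanDuminilCopinSidoraviciusCMP2015, Thm. 1.2 with Cor. 1.5 (1)] -/
theorem tendsto_rcMeasure_real_siteArm_criticalBeta (hd : 3 ≤ d) (v x : Site d) :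
    Tendsto (fun L : ℕ => (μ[fkIsingParam (criticalBeta d), 2](Λ⟦v, L⟧)).real
      {ω | ∃ a y : ↥Λ⟦v, L⟧, a.1 = x ∧ y ∈ wiredBoundary (zdGraph d) Λ⟦v, L⟧ ∧
        (openGraph ω).Reachable a y}) atTop (𝓝 0) := by
  have hd0 : 0 < d := by omega
  have hp := fkIsingParam_mem_Icc (criticalBeta_nonneg (d := d))
  have hθ := (tendsto_thetaWiredBox_criticalBeta_zero hd).comp (tendsto_sub_atTop_nat (siteRad (x - v)))
  refine squeeze_zero' (Eventually.of_forall fun L => measureReal_nonneg) ?_ hθ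
  filter_upwards [eventually_ge_atTop (siteRad (x - v))] with L hL
  exact rcMeasure_real_siteArm_icc_le_thetaWiredBox hd0 hp one_le_two x _ (icc_shift_centre_subset x v hL)

end Arm

end Literature.Probability.LatticeModels

end
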